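import Summits.CriticalPhenomena.CardyFormulaZ2.Theorems.CardyIKTransportIKMixedBoxCrossingQuenchedDefs

/-!
# Stub `stub_harris7OfFam` (line `defect-closure-exploration` v7, crux `IKMixedBoxCrossing`, stmt-CriticalPhenomena-5911)

Support file (`--supports stmt-CriticalPhenomena-5911`): the specialisation `Harris7OfFam : ApproxHarrisFam → ApproxHarris7`
of skeleton v7 (`…IKMixedBoxCrossingQuenchedDefs`).  Pure bookkeeping: the seven events of the strategist's symmetry-free
glue inside the `2n × n` box at `(a, b)` are the box events of ONE family `Fin 7 → BoxSpec` (a vector literal; its product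
of probabilities and intersection of events are `glueProduct` / `glueEvent` by `prod_boxProb_seven` / `iInter_boxEvent_seven`
and `Set.preimage_inter`), every box of which is at least `glueShift n = ⌈n/3⌉` wide and `n` tall for `2 ≤ n`; so
`ApproxHarrisFam` at `k = 7` and scale `glueShift n ≥ n₀` (guaranteed by `n ≥ 3 n₀ + 2`) is `ApproxHarris7` at scale `n`.
No new definitions.
-/

noncomputable section

namespace Summit.CriticalPhenomena.CardyFormulaZ2.Cruxes.IKMixedBoxCrossing.QuenchedChainFKG

open scoped Classical BigOperators
open MeasureTheory
open Summit.CriticalPhenomena.CardyFormulaZ2.Theorems.IKLinearTransport.PinnedDiagramExchange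
  (Ω μIK obs lrCross tbCross)
open Summit.CriticalPhenomena.CardyFormulaZ2.Cruxes.IKMixedBoxCrossing.PairedMirrorExploration (pLR pTB)

namespace Harris7

/-! ## §1 Seven-membered families of box specifications -/

/-- The box event of a left–right specification. -/
theorem boxEvent_lr (S : Set ℤ) (a b : ℤ) (w h : ℕ) :
    boxEvent S ⟨true, a, b, w, h⟩ = obs S ⁻¹' lrCross a b w h := rfl

/-- The box event of a bottom–top specification. -/
theorem boxEvent_tb (S : Set ℤ) (a b : ℤ) (w h : ℕ) :
    boxEvent S ⟨false, a, b, w, h⟩ = obs S ⁻¹' tbCross a b w h := rfl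

/-- The product of the annealed probabilities of a family of seven box specifications. -/
theorem prod_boxProb_seven (S : Set ℤ) (b₀ b₁ b₂ b₃ b₄ b₅ b₆ : BoxSpec) :
    ∏ i, boxProb S (![b₀, b₁, b₂, b₃, b₄, b₅, b₆] i) =
      boxProb S b₀ * boxProb S b₁ * boxProb S b₂ * boxProb S b₃ * boxProb S b₄ * boxProb S b₅ * boxProb S b₆ := by
  rw [Fin.prod_univ_seven]
  rfl

/-- The intersection of the events of a family of seven box specifications. -/
theorem iInter_boxEvent_seven (S : Set ℤ) (b₀ b₁ b₂ b₃ b₄ b₅ b₆ : BoxSpec) :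
    ⋂ i, boxEvent S (![b₀, b₁, b₂, b₃, b₄, b₅, b₆] i) =
      boxEvent S b₀ ∩ boxEvent S b₁ ∩ boxEvent S b₂ ∩ boxEvent S b₃ ∩ boxEvent S b₄ ∩ boxEvent S b₅ ∩
        boxEvent S b₆ := by
  ext x
  simp only [Set.mem_iInter, Fin.forall_fin_succ, IsEmpty.forall_iff, and_true, Matrix.cons_val_zero,
    Matrix.cons_val_succ, Set.mem_inter_iff, and_assoc]

end Harris7

open Harris7 in
/-- **THE SEVEN-EVENT GLUE IS A FAMILY** (registered stub `stub_harris7OfFam` of line `defect-closure-exploration` v7):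
`ApproxHarrisFam` at `k = 7` and scale `glueShift n = ⌈n/3⌉` gives `ApproxHarris7` (threshold `3 n₀ + 2`, so that `2 ≤ n` and
`n₀ ≤ glueShift n`; the seven glue boxes have widths `n, n, n, n, n − s, n − s, 2s ≥ s = glueShift n` and height `n ≥ s`). -/
theorem stub_harris7OfFam : Harris7OfFam := by
  intro hF η hη
  obtain ⟨n₀, hn₀⟩ := hF 7 η hη
  refine ⟨3 * n₀ + 2, fun S n hn a b => ?_⟩
  have hs : n₀ ≤ glueShift n := by unfold glueShift; omega
  have h1 : glueShift n ≤ n := by unfold glueShift; omega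
  have h2 : glueShift n ≤ n - glueShift n := by unfold glueShift; omega
  have h3 : glueShift n ≤ 2 * glueShift n := by omega
  have key := hn₀ S (glueShift n) hs
    ![⟨true, a, b, n, n⟩, ⟨true, a + glueShift n, b, n, n⟩, ⟨true, a + 2 * glueShift n, b, n, n⟩,
      ⟨true, a + n, b, n, n⟩, ⟨false, a + glueShift n, b, n - glueShift n, n⟩,
      ⟨false, a + 2 * glueShift n, b, n - glueShift n, n⟩, ⟨false, a + n, b, 2 * glueShift n, n⟩]
    (by
      simp only [Fin.forall_fin_succ, IsEmpty.forall_iff, and_true, Matrix.cons_val_zero, Matrix.cons_val_succ]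
      exact ⟨⟨h1, h1⟩, ⟨h1, h1⟩, ⟨h1, h1⟩, ⟨h1, h1⟩, ⟨h2, h1⟩, ⟨h2, h1⟩, ⟨h3, h1⟩⟩)
  rw [prod_boxProb_seven, iInter_boxEvent_seven] at key
  simpa only [boxProb_lr, boxProb_tb, boxEvent_lr, boxEvent_tb, ← Set.preimage_inter, glueProduct, glueEvent] using key

end Summit.CriticalPhenomena.CardyFormulaZ2.Cruxes.IKMixedBoxCrossing.QuenchedChainFKG

end
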